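import Summits.BirchSwinnertonDyer.BirchSwinnertonDyer.Theorems.EisensteinPrimesGoodLatticeBDPValueFullDescentFiveLe
import Summits.BirchSwinnertonDyer.BirchSwinnertonDyer.Theorems.EisensteinPrimesFullDescentTheoremBPrime
import HarnessLib

/-!
# Route `EisensteinPrimes`, crux 2 `GoodLatticeBDPValue` (stmt-BirchSwinnertonDyer-19032), line `halves` v25, road
# R5 / AN-5 — **T⁗: the full-descent datum at EVERY odd good Eisenstein prime, with NO normalisation**
# (assembled from Theorem A_p and Theorem B_p; one road at every odd `p`)

Cell `bsd-eis` (home `run/shared/lean/pub/bsd-eis/`), width seat `bsd-line-x1-p1-w6` (gen 8; `--supports -19032 --as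
helper`, closes nothing by itself). Bus `STATUS.md` 2026-08-28 22:12:53Z («taken B_p + T⁗»). The road R5 / AN-5 of width
seat -w7 g7 proves T‴ = «`5 ≤ p`, `p` good, `E[p]` reducible, NO RATIONAL `p`-LINE UNRAMIFIED AT `p` ⟹ `E` has an
additive prime, or a multiplicative `ℓ` with `a_ℓ ≡ ℓ (mod p)`» (`FullDescentAssemblyPrime.fullDescentDatum_of_theoremA`,
slot `hA` = Theorem A_p «Case `ω` ⇒ ⊥»); LEAD g5's T′ (`GoodLatticeBDPValueFullDescentStub.stub_fullDescentAtThreeOfRed`) is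
the case `p = 3` with no normalisation. This file removes the normalisation at every odd `p`:

* §1 `lineCharacter_eq_one_of_lineUnramifiedAt` — for a SEMISTABLE curve, a rational `p`-line `⟨P⟩` UNRAMIFIED at `p`
  has trivial character (`r = χ̄_p^k` by Lemma S′ `FullDescentMultiplicativeUnipotentLine.exists_lineCharacter_eq_pow_of_
  good_or_mult`; the inertia group at `p` fixes `P` and maps onto `(ℤ/p)ˣ` under `χ̄_p`
  (`FullDescentOrdinaryNine.Rat.exists_mem_absInertia_modNCyclotomicCharacter_absGaloisRestrict_eq`), so `u^k = 1` for
  every unit) — the complement of w5 g6's LS-ω_p `FullDescentLemmaSOmega.lineCharacter_eq_modNCyclotomicCharacter`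
  (ramified ⟹ `r = χ̄_p`);
* §2 `add_one_modEq_zero_of_not_split_of_fixed` — the `𝟙`-line twin of -w7 g7's
  `FullDescentAssemblyPrime.add_one_modEq_zero_of_not_split_of_omega`: a non-split multiplicative `ℓ ≠ p` of a curve
  with a `Γ_ℚ`-FIXED `P ≠ 0` in `E[p]` has `ℓ + 1 ≡ 0 (mod p)` (`{φ(ℓ), ψ(ℓ)} = {−ℓ, −1}` on `⟨P⟩` with
  `(φ, ψ) = (𝟙, χ̄_p)`, all `ℓ` by this seat's `lineChars_natCast_of_not_hasSplitMultiplicativeReductionAtPrime'`);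
* §3 **`fullDescentDatum_of_theoremA'`** — the slot-`hA` assembly WITHOUT the normalisation binder:
  `(hA : Theorem A_p) → ∀ W p, p ≠ 2 → Good W p → Red W p → datum`, ONE road at every odd `p` (also `p = 3`, where it
  re-proves T′): the rational line `⟨P⟩` (Mazur 1978 §5 API) is either ramified at `p` — then LS-ω_p makes it the
  `ω`-line and `hA` applies, as in -w7's assembly — or unramified at `p` — then §1 makes `P` a FIXED point, §2 / the
  split dictionary give the datum at a non-split `ℓ` / a split `ℓ ≡ 1`, and otherwise THEOREM B_p
  (`FullDescentTheoremBPrime.exists_omega_point_of_fixed_point`, Herbrand splitting) produces an `ω`-point, to which `hA`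
  applies;
* §4 **`fullDescentDatum_of_good_of_red`** — T⁗ UNCONDITIONALLY, from §3 and -w7 g7's `theoremA_prime`
  (`GoodLatticeBDPValueFullDescentFiveLe`, the FINAL file of the road: A-I_p ∘ A-II_p, w7 ∘ w3 g13);
* §5 `thm222_anacong_goodLattice_OPEN_of_fullDescentDatum` — bookkeeping: Keller–Yin's every-odd-`p` claim
  `KellerYin2024.thm222_anacong_goodLattice_OPEN` FOLLOWS from the composed-print 3a-A
  `KellerYin2024.thm222_anacong_goodLattice_of_fullDescentDatum` ALONE (feed the datum of §4) — the one-call form of the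
  skeleton's [AN] join `thm222_OPEN_of_slices` (v25: 3a-A ∧ `_of_five_le` ∧ T′).

USE: count-neutral for the skeleton (the consumer `KellerYin2024.thm222_anacong_goodLattice_of_five_le` carries
the normalisation anyway); it is the quotable end-form of T′/T‴ — Ribet–Yoo necessity «odd good `p`, rational `p`-isogeny
⟹ Kriz full Eisenstein descent datum» with no side condition — and lets the [AN] join feed 3a-A
`…_of_fullDescentDatum` at every odd `p` by ONE datum theorem.

HONEST FRAMING: helper theorems only (0 definitions, 0 named facts, 0 sorry); no summit statement, no BSD / IMC /
Keller–Yin theorem and no stub of the registered skeleton is proved by this file. References: [Mazur1977] III §5;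
[Mazur1978] §5; [Kriz2016] Thm. 34, Def. 31, Rem. 33; [Yoo2019] Thm. 1.3; [SerreInventiones1972] §1.11–1.12;
[GreenbergVatsal2000] §2; [SilvermanATAEC1994] V §3–§5.
-/

set_option autoImplicit false

-- the route's Theorems namespace repeats the summit name by design (D-0017 nested layout)
set_option linter.dupNamespace false

noncomputable section

open scoped Classical NumberField

namespace Summit.BirchSwinnertonDyer.BirchSwinnertonDyer.Theorems.FullDescentDatumOddPrime

open NumberField IsDedekindDomain Field WeierstrassCurve Rat.HeightOneSpectrum
  Literature.NumberTheory.EllipticCurves Literature.NumberTheory.GaloisRepresentations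
  Literature.NumberTheory.EllipticCurves.Rank1Residual
  Summit.BirchSwinnertonDyer.BirchSwinnertonDyer.Theorems
  Summit.BirchSwinnertonDyer.BirchSwinnertonDyer.Theorems.EisensteinPrimesLineCharactersAtMultiplicativePlace
open Summit.BirchSwinnertonDyer.BirchSwinnertonDyer.Theorems.FullDescentLemmaSOmega (isRationalLine_zmultiples
  units_eq_of_val_smul_eq lineCharacter_eq_modNCyclotomicCharacter)
open Summit.BirchSwinnertonDyer.BirchSwinnertonDyer.Theorems.FullDescentAssemblyPrime (smul_eq_of_mem_zmultiples
  smul_sub_smul_mem_zmultiples add_one_modEq_zero_of_natCast_eq_neg_one one_ne_neg_one_zmod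
  add_one_modEq_zero_of_not_split_of_omega fullDescentDatum_of_theoremA)

variable {W : WeierstrassCurve ℚ} [W.IsElliptic] {p : ℕ} [hp : Fact p.Prime]

/-! ## §1. An UNRAMIFIED rational line of a semistable curve is the `𝟙`-line -/

omit hp in
/-- For a semistable `W/ℚ`, every finite place `v ∤ p` is good or multiplicative (prime/place dictionary). [folklore] -/
theorem good_or_mult_of_semistable (hsemi : Semistable W) :
    ∀ v : HeightOneSpectrum (𝓞 ℚ), (p : 𝓞 ℚ) ∉ v.asIdeal →
      W.HasGoodReductionAt v ∨ W.HasMultiplicativeReductionAt v := by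
  -- adapted from w5 g6's `FullDescentLemmaSOmega.lineCharacter_eq_modNCyclotomicCharacter` (first step)
  intro v _
  haveI hℓ : Fact (primesEquiv v : ℕ).Prime := Fact.mk (primesEquiv v).2
  have hℓv : (((primesEquiv v : Nat.Primes) : ℕ) : 𝓞 ℚ) ∈ v.asIdeal := natCast_mem_asIdeal_of_primesEquiv_eq rfl
  rcases hsemi (primesEquiv v : ℕ) (primesEquiv v).2 with hg | hm
  · exact Or.inl (W.hasGoodReductionAt_of_hasGoodReductionAtPrime v hℓv hg)
  · exact Or.inr (Summit.BirchSwinnertonDyer.Rank1Residual.X2.GreenbergVatsalStrictSelmerMultiplicative.hasMultiplicativeReductionAt_of_mem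
      W (primesEquiv v : ℕ) hm hℓv)

/-- **LS-𝟙_p.** `W/ℚ` SEMISTABLE, `p` a prime, `P ≠ 0` a point of `E[p]` with isogeny character `r` (`σ P = r(σ) P`)
whose line `⟨P⟩` IS unramified at `p`. Then `r = 𝟙`: Lemma S′ gives `r = χ̄_p^k`; the inertia groups above `p` fix `P`,
and `χ̄_p` maps the local inertia group onto `(ℤ/p)ˣ`, so `u^k = 1` for every unit. (The complement of LS-ω_p.)
[cite: Mazur1978, §5 Lemma 5.2–5.3, Prop. 5.1 (pp. 149–152)] [cite: SerreInventiones1972, §1.8 Prop. 8, §1.12] -/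
theorem lineCharacter_eq_one_of_lineUnramifiedAt (hsemi : Semistable W)
    {P : geomTorsion W (p : ℤ)} (hP0 : P ≠ 0) {r : absoluteGaloisGroup ℚ →* (ZMod p)ˣ}
    (hr : ∀ σ : absoluteGaloisGroup ℚ, σ • P = ((r σ : (ZMod p)ˣ) : ZMod p).val • P)
    (hunr : LineUnramifiedAt W p (AddSubgroup.zmultiples P)) :
    ∀ σ : absoluteGaloisGroup ℚ, r σ = 1 := by
  have hpp : p.Prime := hp.out
  haveI : Fact (1 < p) := ⟨hpp.one_lt⟩
  obtain ⟨k, hk⟩ := FullDescentMultiplicativeUnipotentLine.exists_lineCharacter_eq_pow_of_good_or_mult W p hP0 hr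
    (good_or_mult_of_semistable (p := p) hsemi)
  -- the place `v` above `p`
  obtain ⟨v, hv'⟩ : ∃ v : HeightOneSpectrum (𝓞 ℚ), primesEquiv v = ⟨p, hpp⟩ :=
    ⟨(primesEquiv (R := 𝓞 ℚ)).symm ⟨p, hpp⟩, Equiv.apply_symm_apply _ _⟩
  have hv : natGenerator v = p := congrArg Subtype.val hv'
  have hpv : (p : 𝓞 ℚ) ∈ v.asIdeal := (Rat.natCast_mem_asIdeal_iff v).mpr (hv ▸ dvd_refl _)
  -- `χ̄_p(I_p) = (ℤ/p)ˣ` and `I_p` fixes `P`: `u ^ k = 1`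
  have hpow : ∀ u : (ZMod p)ˣ, u ^ k = 1 := by
    intro u
    obtain ⟨τ, hτ, hτu⟩ :=
      FullDescentOrdinaryNine.Rat.exists_mem_absInertia_modNCyclotomicCharacter_absGaloisRestrict_eq p v hpv u
    have hmem : absGaloisRestrict ℚ (v.adicCompletion ℚ) τ ∈
        (adicCompletionPrime ℚ v).inertia (absoluteGaloisGroup ℚ) := by
      rw [inertia_adicCompletionPrime_eq_map_absInertia ℚ v]
      exact Subgroup.mem_map_of_mem _ hτ
    have hfix := hunr v hpv _ (adicCompletionPrime_mem_primesAbove ℚ v) _ hmem P (AddSubgroup.mem_zmultiples P)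
    have h2 := hr (absGaloisRestrict ℚ (v.adicCompletion ℚ) τ)
    rw [hk, hτu, hfix] at h2
    -- `P = (u^k).val • P`, i.e. `(1 : units).val • P = (u^k).val • P`
    have h3 : (((1 : (ZMod p)ˣ) : ZMod p)).val • (P : geomPoints W) =
        (((u ^ k : (ZMod p)ˣ) : ZMod p)).val • (P : geomPoints W) := by
      rw [Units.val_one, ZMod.val_one, one_smul]
      have h2' := congrArg (Subtype.val : geomTorsion W (p : ℤ) → geomPoints W) h2
      rwa [AddSubgroupClass.coe_nsmul] at h2'
    exact (units_eq_of_val_smul_eq hP0 h3).symm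
  intro σ
  rw [hk σ, hpow]

/-! ## §2. L2 of the road on the `𝟙`-line: a NON-split multiplicative `ℓ ≠ p` has `ℓ ≡ −1 (mod p)` -/

/-- **A non-split multiplicative prime `ℓ ≠ p` of a curve carrying a `Γ_ℚ`-FIXED point `P ≠ 0` in `E[p]` has
`ℓ + 1 ≡ 0 (mod p)`** (every `ℓ`, also `ℓ = 2`; `p` odd). At the place `v = (ℓ)` the twisted Tate curve gives
`{φ(ℓ), ψ(ℓ)} = {−ℓ, −1}` for the line character `φ` and the quotient character `ψ`
(`lineChars_natCast_of_not_hasSplitMultiplicativeReductionAtPrime'`, all `ℓ`); on the `𝟙`-line `(φ, ψ) = (𝟙, χ̄_p)`, so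
`φ(ℓ) = 1 ≠ −1` (`p` odd) forces `ψ(ℓ) = ℓ = −1`. The `𝟙`-twin of
`FullDescentAssemblyPrime.add_one_modEq_zero_of_not_split_of_omega`. [cite: Kriz2016, Thm. 34 (2)]
[cite: GreenbergVatsal2000, §2 pp. 14–15] [cite: SilvermanATAEC1994, Ch. V Thm. 5.3, Cor. 5.4, Ex. 5.11] -/
theorem add_one_modEq_zero_of_not_split_of_fixed [W.IsGloballyMinimal] (hp2 : p ≠ 2)
    {P : geomTorsion W (p : ℤ)} (hP0 : P ≠ 0) (hfix : ∀ σ : absoluteGaloisGroup ℚ, σ • P = P)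
    (v : HeightOneSpectrum (𝓞 ℚ)) (hvp : natGenerator v ≠ p)
    (hmult : haveI := Fact.mk (primesEquiv v).2; W.HasMultiplicativeReductionAtPrime (primesEquiv v : ℕ))
    (hns : haveI := Fact.mk (primesEquiv v).2; ¬ W.HasSplitMultiplicativeReductionAtPrime (primesEquiv v : ℕ)) :
    natGenerator v + 1 ≡ 0 [MOD p] := by
  -- adapted from -w7 g7's `FullDescentAssemblyPrime.add_one_modEq_zero_of_not_split_of_omega` (rôles of φ, ψ swapped)
  have hpp : p.Prime := hp.out
  haveI : Fact (1 < p) := ⟨hpp.one_lt⟩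
  haveI hℓ : Fact (primesEquiv v : ℕ).Prime := Fact.mk (primesEquiv v).2
  have hv : ((primesEquiv v : Nat.Primes) : ℕ) = natGenerator v := rfl
  -- the trivial isogeny character of the fixed point
  have hr : ∀ τ : absoluteGaloisGroup ℚ, τ • P = (((1 : absoluteGaloisGroup ℚ →* (ZMod p)ˣ) τ : (ZMod p)ˣ) :
      ZMod p).val • P := fun τ ↦ by
    rw [MonoidHom.one_apply, Units.val_one, ZMod.val_one, one_smul, hfix τ]
  have hΦ := isRationalLine_zmultiples hP0 (r := (1 : absoluteGaloisGroup ℚ →* (ZMod p)ˣ)) hr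
  -- `ℓ` is a unit mod `p`
  have hℓp : ¬ natGenerator v ∣ p := fun h ↦
    hvp ((Nat.prime_dvd_prime_iff_eq (prime_natGenerator v) hpp).mp h)
  have hu : IsUnit ((natGenerator v : ℕ) : ZMod p) := by
    rw [← ZMod.coe_unitOfCoprime (natGenerator v) ((Nat.coprime_primes (prime_natGenerator v)
      hpp).mpr (fun h ↦ hvp h))]
    exact Units.isUnit _
  obtain ⟨u, hu'⟩ := hu
  -- the identity Dirichlet character mod `p` with values in `ℤ/p`
  set idχ : DirichletCharacter (ZMod p) p := MulChar.ofUnitHom (MonoidHom.id (ZMod p)ˣ) with hidχ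
  have hidχ_apply : ∀ w : (ZMod p)ˣ, idχ (w : ZMod p) = (w : ZMod p) := fun w ↦ by
    rw [hidχ, MulChar.ofUnitHom_coe, MonoidHom.id_apply]
  have hidχ_ℓ : idχ ((natGenerator v : ℕ) : ZMod p) = ((natGenerator v : ℕ) : ZMod p) := by
    rw [← hu', hidχ_apply]
  have hone_ℓ1 : (1 : DirichletCharacter (ZMod p) 1) ((natGenerator v : ℕ) : ZMod 1) = 1 :=
    MulChar.one_apply (isUnit_of_subsingleton _)
  -- the `𝟙`-line: `φ = 𝟙` (mod 1), `ψ = χ̄_p` (mod p)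
  have hφ0 : ∀ σ : absoluteGaloisGroup ℚ, ∀ Q ∈ AddSubgroup.zmultiples P,
      σ • Q = ((1 : DirichletCharacter (ZMod p) 1)
        ((modNCyclotomicCharacter ℚ 1 σ : (ZMod 1)ˣ) : ZMod 1)).val • Q := by
    intro σ Q hQ
    rw [MulChar.one_apply_coe, smul_eq_of_mem_zmultiples hr σ hQ, MonoidHom.one_apply, Units.val_one]
  have hψ0 : ∀ (σ : absoluteGaloisGroup ℚ) (Q : geomTorsion W (p : ℤ)),
      σ • Q - (idχ ((modNCyclotomicCharacter ℚ p σ : (ZMod p)ˣ) : ZMod p)).val • Q ∈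
        AddSubgroup.zmultiples P := by
    intro σ Q
    have h := smul_sub_smul_mem_zmultiples hP0 hr σ Q
    rwa [MonoidHom.one_apply, inv_one, Units.val_one, mul_one, ← hidχ_apply] at h
  rcases lineChars_natCast_of_not_hasSplitMultiplicativeReductionAtPrime' (p := p) hv hvp hmult hns hΦ
      (1 : DirichletCharacter (ZMod p) 1) (fun h ↦ (prime_natGenerator v).ne_one (Nat.dvd_one.mp h)) idχ hℓp hφ0 hψ0
    with ⟨hφ, -⟩ | ⟨hφ, -⟩
  · rw [hone_ℓ1] at hφ
    exact add_one_modEq_zero_of_natCast_eq_neg_one (neg_eq_iff_eq_neg.mp hφ.symm)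
  · rw [hone_ℓ1] at hφ
    exact absurd hφ (one_ne_neg_one_zmod hp2)

/-! ## §3. The assembly WITHOUT normalisation: T⁗ from Theorem A_p (and Theorem B_p, T′) -/

/-- **T⁗ from Theorem A_p (slot `hA`, -w7 g7's shape): at EVERY odd good prime `p` with `E[p]` reducible, `E/ℚ` has a
prime of additive reduction, or a multiplicative prime `ℓ` that is split with `ℓ ≡ 1 (mod p)` or non-split with
`ℓ + 1 ≡ 0 (mod p)`** — NO normalisation «no rational `p`-line unramified at `p`», one road at every odd `p` (at `p = 3`
it re-proves LEAD g5's T′ `GoodLatticeBDPValueFullDescentStub.stub_fullDescentAtThreeOfRed`, which came from Kummer theory).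
The rational line `⟨P⟩` (Mazur 1978 §5) is either ramified at `p` — then it is the `ω`-line (w5 g6's LS-ω_p) and `hA`
concludes, exactly as in -w7 g7's `fullDescentDatum_of_theoremA` — or unramified at `p` — then `P` is a FIXED point (§1), a
non-split multiplicative `ℓ` has `ℓ + 1 ≡ 0` (§2), a split `ℓ ≡ 1` is a datum, and otherwise Theorem B_p
(`FullDescentTheoremBPrime.exists_omega_point_of_fixed_point`, Herbrand) yields an `ω`-point to which `hA` applies.
[cite: Yoo2019, Thm. 1.3] [cite: Kriz2016, Thm. 34 (1)–(3), Thm. 35, Def. 31, Rem. 32–33] [cite: Mazur1977, III §5]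
[cite: Mazur1978, §5 (pp. 148–152)] [cite: SerreInventiones1972, §1.11 Prop. 12] -/
theorem fullDescentDatum_of_theoremA'
    (hA : ∀ (W : WeierstrassCurve ℚ) [W.IsElliptic] [W.IsGloballyMinimal] (p : ℕ) [Fact p.Prime],
      p ≠ 2 → W.HasGoodReductionAtPrime p → ¬ (p : ℤ) ∣ W.frobeniusTrace p →
      (∀ v : HeightOneSpectrum (𝓞 ℚ), natGenerator v ≠ p →
        W.HasGoodReductionAt v ∨ (W.HasSplitMultiplicativeReductionAt v ∧ ¬ natGenerator v ≡ 1 [MOD p])) →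
      ∀ Q : geomTorsion W (p : ℤ), Q ≠ 0 →
        (∀ σ : absoluteGaloisGroup ℚ, σ • Q = ((modNCyclotomicCharacter ℚ p σ : (ZMod p)ˣ) : ZMod p).val • Q) →
        False) :
    ∀ (W : WeierstrassCurve ℚ) [W.IsElliptic] [W.IsGloballyMinimal] (p : ℕ) [Fact p.Prime],
      p ≠ 2 → Good W p → Red W p →
      ((∃ (ℓ : ℕ) (hℓ : ℓ.Prime), haveI : Fact ℓ.Prime := ⟨hℓ⟩; Addv W ℓ) ∨
        (∃ (ℓ : ℕ) (hℓ : ℓ.Prime), haveI : Fact ℓ.Prime := ⟨hℓ⟩;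
          W.HasMultiplicativeReductionAtPrime ℓ ∧
            ((W.HasSplitMultiplicativeReductionAtPrime ℓ ∧ ℓ ≡ 1 [MOD p]) ∨
              (¬ W.HasSplitMultiplicativeReductionAtPrime ℓ ∧ ℓ + 1 ≡ 0 [MOD p])))) := by
  intro W _ _ p _ hp2 hgood hred
  have hpp : p.Prime := Fact.out
  have h2p : 2 < p := lt_of_le_of_ne hpp.two_le (Ne.symm hp2)
  by_cases hadd : ∃ (ℓ : ℕ) (hℓ : ℓ.Prime), haveI : Fact ℓ.Prime := ⟨hℓ⟩; Addv W ℓ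
  · exact Or.inl hadd
  -- no additive prime: `W` is semistable
  have hsemi : Semistable W := by
    intro ℓ hℓ
    haveI : Fact ℓ.Prime := ⟨hℓ⟩
    by_contra h
    rw [not_or] at h
    exact hadd ⟨ℓ, hℓ, h⟩
  -- ordinarity of the good Eisenstein prime `p`
  have hord : ¬ (p : ℤ) ∣ W.frobeniusTrace p := (goodOrd_of_red_of_good W p h2p hgood hred).2
  -- the rational line and its isogeny character
  obtain ⟨H, hHst, hHcard⟩ := (Mazur1978.not_hasIrreducibleModPGaloisRep_iff_exists_natCard_eq W p).mp hred
  obtain ⟨P, hP0, rfl⟩ := Mazur1978.exists_eq_zmultiples_of_natCard_eq W p hHcard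
  obtain ⟨r, hr⟩ := Mazur1978.exists_isogenyCharacter W p hP0 (fun σ ↦ hHst σ P (AddSubgroup.mem_zmultiples P))
  by_cases hram : ¬ LineUnramifiedAt W p (AddSubgroup.zmultiples P)
  · -- the RAMIFIED line is the `ω`-line (LS-ω_p): Theorem A_p, dispatched as in -w7 g7's assembly
    have hω' := lineCharacter_eq_modNCyclotomicCharacter (W := W) (p := p) hp2 hgood hord hsemi hP0 hr hram
    have hω : ∀ σ : absoluteGaloisGroup ℚ,
        σ • P = ((modNCyclotomicCharacter ℚ p σ : (ZMod p)ˣ) : ZMod p).val • P := fun σ ↦ by rw [hr σ, hω' σ]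
    right
    by_contra hno
    have hH : ∀ v : HeightOneSpectrum (𝓞 ℚ), natGenerator v ≠ p →
        W.HasGoodReductionAt v ∨ (W.HasSplitMultiplicativeReductionAt v ∧ ¬ natGenerator v ≡ 1 [MOD p]) := by
      intro v hvp
      haveI hℓ : Fact (primesEquiv v : ℕ).Prime := Fact.mk (primesEquiv v).2
      have hv : ((primesEquiv v : Nat.Primes) : ℕ) = natGenerator v := rfl
      rcases hsemi (primesEquiv v : ℕ) (primesEquiv v).2 with hg | hm
      · exact Or.inl ((hasGoodReductionAtPrime_iff_hasGoodReductionAt_ringOfIntegers v W).mp hg)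
      · right
        by_cases hsplit : W.HasSplitMultiplicativeReductionAtPrime (primesEquiv v : ℕ)
        · refine ⟨Summit.BirchSwinnertonDyer.Rank1Residual.X2.GreenbergVatsalStrictSelmerMultiplicative.hasSplitMultiplicativeReductionAt_of_mem W
            (primesEquiv v : ℕ) hsplit (natCast_mem_asIdeal_of_primesEquiv_eq hv), ?_⟩
          intro h1
          exact hno ⟨(primesEquiv v : ℕ), (primesEquiv v).2, hm, Or.inl ⟨hsplit, h1⟩⟩
        · exact absurd ⟨(primesEquiv v : ℕ), (primesEquiv v).2, hm, Or.inr ⟨hsplit,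
            add_one_modEq_zero_of_not_split_of_omega hp2 hP0 hω v hvp hm hsplit⟩⟩ hno
    exact hA W p hp2 hgood hord hH P hP0 hω
  · -- the UNRAMIFIED line is the `𝟙`-line (§1): `P` is fixed; Theorem B_p supplies an `ω`-point for Theorem A_p
    rw [not_not] at hram
    have h1 := lineCharacter_eq_one_of_lineUnramifiedAt (W := W) (p := p) hsemi hP0 hr hram
    have hfix : ∀ σ : absoluteGaloisGroup ℚ, σ • P = P := fun σ ↦ by
      haveI : Fact (1 < p) := ⟨hpp.one_lt⟩
      rw [hr σ, h1 σ, Units.val_one, ZMod.val_one, one_smul]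
    right
    by_contra hno
    have hH : ∀ v : HeightOneSpectrum (𝓞 ℚ), natGenerator v ≠ p →
        W.HasGoodReductionAt v ∨ (W.HasSplitMultiplicativeReductionAt v ∧ ¬ natGenerator v ≡ 1 [MOD p]) := by
      intro v hvp
      haveI hℓ : Fact (primesEquiv v : ℕ).Prime := Fact.mk (primesEquiv v).2
      have hv : ((primesEquiv v : Nat.Primes) : ℕ) = natGenerator v := rfl
      rcases hsemi (primesEquiv v : ℕ) (primesEquiv v).2 with hg | hm
      · exact Or.inl ((hasGoodReductionAtPrime_iff_hasGoodReductionAt_ringOfIntegers v W).mp hg)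
      · right
        by_cases hsplit : W.HasSplitMultiplicativeReductionAtPrime (primesEquiv v : ℕ)
        · refine ⟨Summit.BirchSwinnertonDyer.Rank1Residual.X2.GreenbergVatsalStrictSelmerMultiplicative.hasSplitMultiplicativeReductionAt_of_mem W
            (primesEquiv v : ℕ) hsplit (natCast_mem_asIdeal_of_primesEquiv_eq hv), ?_⟩
          intro h1'
          exact hno ⟨(primesEquiv v : ℕ), (primesEquiv v).2, hm, Or.inl ⟨hsplit, h1'⟩⟩
        · exact absurd ⟨(primesEquiv v : ℕ), (primesEquiv v).2, hm, Or.inr ⟨hsplit,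
            add_one_modEq_zero_of_not_split_of_fixed hp2 hP0 hfix v hvp hm hsplit⟩⟩ hno
    obtain ⟨Q, hQ0, hQ⟩ :=
      FullDescentTheoremBPrime.exists_omega_point_of_fixed_point W hp2 hgood hord hH P hP0 hfix
    exact hA W p hp2 hgood hord hH Q hQ0 hQ

/-! ## §4. T⁗, unconditionally -/

/-- **T⁗ (Ribet–Yoo / Kriz full-descent necessity at a good Eisenstein prime, NO side condition).** For `E/ℚ` (globally
minimal model `W`), `p` an ODD prime of GOOD reduction with `E[p]` REDUCIBLE (a rational `p`-isogeny): `E` has a prime of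
additive reduction, or a prime `ℓ` of multiplicative reduction that is split with `ℓ ≡ 1 (mod p)` or non-split with
`ℓ + 1 ≡ 0 (mod p)` — i.e. a multiplicative `ℓ` with `a_ℓ(E) ≡ ℓ (mod p)`, Kriz's full Eisenstein descent datum. §3 fed with
-w7 g7's Theorem A_p `GoodLatticeBDPValueFullDescentFiveLe.theoremA_prime` (A-I_p ∘ A-II_p: Herbrand splitting at
`(C, E[p], p⁻¹C)`, the cyclic `Γ_ℚ`-stable `B ≤ E[p²]` of order `p²` has character `χ̄_{p²}`, and `Γ_ℚ` trivial on `E[p²]/B`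
contradicts `#Ẽ(𝔽_p) ≤ 2p + 1`). Generalises LEAD g5's T′ (`p = 3`) and -w7 g7's T‴ (`5 ≤ p` under the good-lattice
normalisation) — every input a tree theorem; unconditional. [cite: Yoo2019, Thm. 1.3] [cite: Kriz2016, Thm. 34 (1)–(3), Def. 31 (5), Rem. 33]
[cite: Mazur1977, III §5] [cite: Mazur1978, §5] [cite: SerreInventiones1972, §1.11 Prop. 11–12] -/
theorem fullDescentDatum_of_good_of_red :
    ∀ (W : WeierstrassCurve ℚ) [W.IsElliptic] [W.IsGloballyMinimal] (p : ℕ) [Fact p.Prime],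
      p ≠ 2 → Good W p → Red W p →
      ((∃ (ℓ : ℕ) (hℓ : ℓ.Prime), haveI : Fact ℓ.Prime := ⟨hℓ⟩; Addv W ℓ) ∨
        (∃ (ℓ : ℕ) (hℓ : ℓ.Prime), haveI : Fact ℓ.Prime := ⟨hℓ⟩;
          W.HasMultiplicativeReductionAtPrime ℓ ∧
            ((W.HasSplitMultiplicativeReductionAtPrime ℓ ∧ ℓ ≡ 1 [MOD p]) ∨
              (¬ W.HasSplitMultiplicativeReductionAtPrime ℓ ∧ ℓ + 1 ≡ 0 [MOD p])))) :=
  fullDescentDatum_of_theoremA' GoodLatticeBDPValueFullDescentFiveLe.theoremA_prime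

/-! ## §5. Bookkeeping: Keller–Yin's every-odd-`p` [AN] claim from 3a-A alone -/

/-- **`KellerYin2024.thm222_anacong_goodLattice_OPEN` (the every-odd-`p` [AN] statement, a PREPRINT CLAIM as a named fact)
FOLLOWS from the composed-print 3a-A `KellerYin2024.thm222_anacong_goodLattice_of_fullDescentDatum` alone** — feed the
datum of T⁗ (§4). Pure logic over §4; the one-call form of the crux-2 skeleton's [AN] join (`thm222_OPEN_of_slices`: v25 reads
3a-A ∧ `_of_five_le` ∧ T′). Nothing about the truth of either named fact is asserted. [cite: KellerYin2024, Thm. 2.2.2 (arXiv:2402.12781v2 TeX L1445–1448) — statement shape]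
[cite: CastellaGrossiLeeSkinner2022, Thms. 2.2.1/2.2.2 with (2.16)] [cite: Kriz2016, Def. 31 (5), Rem. 33, Thm. 34 (3), Thm. 35] -/
theorem thm222_anacong_goodLattice_OPEN_of_fullDescentDatum
    (h3 : KellerYin2024.thm222_anacong_goodLattice_of_fullDescentDatum) :
    KellerYin2024.thm222_anacong_goodLattice_OPEN :=
  fun W _ _ p _ hp hgood hred hanom hlat K _ _ hK hH hHp hodd hd3 htor ι v vbar hv hvbar hne κ hκ γ _
      N _ Dt ι' hι' ΩK Ωp L hΩ hL θsub θquot hpair Sf hSf θK hθK Cbar hC ΩK' Ωp' Lφ hΩ' hLφ ↦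
    h3 W p hp hgood hred hanom (fullDescentDatum_of_good_of_red W p (by omega) hgood hred) hlat K hK hH hHp hodd
      hd3 htor ι v vbar hv hvbar hne κ hκ γ N Dt ι' hι' ΩK Ωp L hΩ hL θsub θquot hpair Sf hSf θK hθK Cbar hC ΩK'
      Ωp' Lφ hΩ' hLφ

end Summit.BirchSwinnertonDyer.BirchSwinnertonDyer.Theorems.FullDescentDatumOddPrime

end
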